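import Mathlib
import HarnessLib
import Literature.Analysis.FluidPDE.VectorCalculus

/-!
# Horizontal convolution of a bounded `C²` field with an `L¹` kernel: derivatives fall on the field

Seat ns-poloidal-K2-p2 g6 (interim lead-of-record on crux K2 `PoloidalWindowRigidity` = stmt-NavierStokesRegularity-19708;
line `mixed_type` v1; item stmt-20428 `LrcModEntire`).  File 5a of the Lean port of **Theorem A** of memo TH-ELLIPTIC-LIOUVILLE-g6
(semi-elliptic (TH) Liouville; files 1–3 = `…VerticalConvexity` p571291, `…WeightedIBP` p572071, `…WeightedYoung` p573065).
The assembly (BRIEF-ThmA-port.md, ADDENDUM) applies the 1-D core to `u(z,·) = w(z,·) ⋆ₕ φ` with ALL horizontal derivatives put on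
`w` — so that only `φ ∈ L¹` is needed to differentiate, the domination being `‖φ(y)·Dᵏw(x−y)‖ ≤ M|φ(y)|`.  This file is that
calculus, for a vector-valued field `W : E → F` (so that it applies to `w`, `Dw`, `∇w` alike):

* `hconv W φ x = ∫ y, φ y • W (x − y)`;  `norm_hconv_le` (`‖W‖ ≤ M ⇒ ‖W ⋆ φ‖ ≤ M‖φ‖₁`);  `continuous_hconv`;
* `hasFDerivAt_hconv` — `D(W ⋆ φ)(x) = (DW ⋆ φ)(x)` for `W ∈ C¹` with `W`, `DW` bounded (dominated differentiation);
  `fderiv_hconv`, `differentiable_hconv`, `contDiff_one_hconv`, `contDiff_two_hconv`;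
* scalar corollaries: `gradient_hconv` (`∇(w ⋆ φ) = (∇w) ⋆ φ`), `divergence_gradient_hconv` (`div∇(w ⋆ φ) = (div∇ w) ⋆ φ`);
* `hasDerivAt_hconv_param` — a `z`-family: `∂_z (w(z,·) ⋆ φ)(x) = (∂_z w(z,·) ⋆ φ)(x)` under `|∂_z w| ≤ M`.

WHAT THIS IS NOT: not a claim about Navier–Stokes — parametric-integral calculus on `ℝᵈ` (bears_on LADDER-NS N0 via crux K2 = stmt-19708 / item 20428).
-/

-- the summit and its single sub-problem share the name (CONVENTIONS §1)
set_option linter.dupNamespace false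

noncomputable section

namespace Summit.NavierStokesRegularity.NavierStokesRegularity.Theorems.PoloidalWindowDoorPoloidalWindowRigidityHorizontalConvolution

open Set Function Filter Topology MeasureTheory InnerProductSpace
open scoped RealInnerProductSpace

variable {E : Type*} [NormedAddCommGroup E] [InnerProductSpace ℝ E] [FiniteDimensional ℝ E]
variable {F : Type*} [NormedAddCommGroup F] [NormedSpace ℝ F]

/-! ### Definition and the basic bound -/

omit [InnerProductSpace ℝ E] [FiniteDimensional ℝ E] in
/-- The integrand of `hconv` is dominated by `M |φ|`. -/
theorem norm_smul_shift_le {W : E → F} {M : ℝ} (hM : ∀ x, ‖W x‖ ≤ M) (φ : E → ℝ) (x y : E) :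
    ‖φ y • W (x - y)‖ ≤ M * |φ y| := by
  rw [norm_smul, Real.norm_eq_abs, mul_comm]
  exact mul_le_mul_of_nonneg_right (hM _) (abs_nonneg _)

/-- The trace, as a continuous linear functional on `E →L[ℝ] E` (finite-dimensional). -/
def traceCLM : (E →L[ℝ] E) →L[ℝ] ℝ :=
  LinearMap.toContinuousLinearMap ((LinearMap.trace ℝ E).comp (ContinuousLinearMap.coeLM ℝ))

/-- `traceCLM L = tr L = div`-type evaluation. -/
theorem traceCLM_apply (L : E →L[ℝ] E) : traceCLM L = LinearMap.trace ℝ E (L : E →ₗ[ℝ] E) := rfl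

/-- `div V (x) = traceCLM (DV(x))`. -/
theorem divergence_eq_traceCLM (V : E → E) (x : E) :
    Literature.Analysis.FluidPDE.VectorCalculus.divergence V x = traceCLM (fderiv ℝ V x) := rfl

section Measure

variable [MeasurableSpace E] [BorelSpace E]

/-- Horizontal convolution with the derivatives on the field: `(W ⋆ φ)(x) = ∫ φ(y) W(x − y) dy`. [folklore] -/
def hconv (W : E → F) (φ : E → ℝ) (x : E) : F := ∫ y, φ y • W (x - y)

/-- Measurability of the integrand for continuous `W` and measurable `φ`. -/
theorem aestronglyMeasurable_smul_shift {W : E → F} (hW : Continuous W) {φ : E → ℝ} (hφ : Integrable φ) (x : E) :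
    AEStronglyMeasurable (fun y => φ y • W (x - y)) volume :=
  hφ.aestronglyMeasurable.smul (hW.comp (continuous_const.sub continuous_id)).aestronglyMeasurable

/-- Integrability of the integrand. -/
theorem integrable_smul_shift {W : E → F} (hW : Continuous W) {M : ℝ} (hM : ∀ x, ‖W x‖ ≤ M) {φ : E → ℝ}
    (hφ : Integrable φ) (x : E) : Integrable (fun y => φ y • W (x - y)) :=
  (hφ.abs.const_mul M).mono' (aestronglyMeasurable_smul_shift hW hφ x)
    (Eventually.of_forall fun y => norm_smul_shift_le hM φ x y)

/-- `‖(W ⋆ φ)(x)‖ ≤ M ∫ |φ|`. [folklore] -/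
theorem norm_hconv_le {W : E → F} {M : ℝ} (hM : ∀ x, ‖W x‖ ≤ M) {φ : E → ℝ}
    (hφ : Integrable φ) (x : E) : ‖hconv W φ x‖ ≤ M * ∫ y, |φ y| := by
  unfold hconv
  calc ‖∫ y, φ y • W (x - y)‖ ≤ ∫ y, ‖φ y • W (x - y)‖ := norm_integral_le_integral_norm _
    _ ≤ ∫ y, M * |φ y| := integral_mono_of_nonneg (Eventually.of_forall fun _ => norm_nonneg _)
        (hφ.abs.const_mul M) (Eventually.of_forall fun y => norm_smul_shift_le hM φ x y)
    _ = M * ∫ y, |φ y| := integral_const_mul _ _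

/-- `W ⋆ φ` is continuous for continuous bounded `W`, integrable `φ` (dominated convergence). [folklore] -/
theorem continuous_hconv {W : E → F} (hW : Continuous W) {M : ℝ} (hM : ∀ x, ‖W x‖ ≤ M) {φ : E → ℝ}
    (hφ : Integrable φ) : Continuous (hconv W φ) := by
  unfold hconv
  exact continuous_of_dominated (fun x => aestronglyMeasurable_smul_shift hW hφ x)
    (fun x => Eventually.of_forall fun y => norm_smul_shift_le hM φ x y) (hφ.abs.const_mul M)
    (Eventually.of_forall fun y => (continuous_const.smul (hW.comp (continuous_id.sub continuous_const))))

/-! ### Differentiation under the integral: the derivative falls on `W` -/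

/-- **`D(W ⋆ φ) = (DW) ⋆ φ`** for `W ∈ C¹` with `W` and `DW` bounded and `φ ∈ L¹`. [folklore] -/
theorem hasFDerivAt_hconv {W : E → F} (hW : ContDiff ℝ 1 W) {M : ℝ} (hM0 : ∀ x, ‖W x‖ ≤ M)
    (hM1 : ∀ x, ‖fderiv ℝ W x‖ ≤ M) {φ : E → ℝ} (hφ : Integrable φ) (x₀ : E) :
    HasFDerivAt (hconv W φ) (hconv (fderiv ℝ W) φ x₀) x₀ := by
  unfold hconv
  have hWc : Continuous W := hW.continuous
  have hDWc : Continuous (fderiv ℝ W) := hW.continuous_fderiv one_ne_zero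
  have hWd : ∀ x, HasFDerivAt W (fderiv ℝ W x) x := fun x => (hW.differentiable one_ne_zero x).hasFDerivAt
  refine hasFDerivAt_integral_of_dominated_of_fderiv_le (μ := (volume : Measure E)) (s := univ)
    (F := fun x y => φ y • W (x - y)) (F' := fun x y => φ y • fderiv ℝ W (x - y)) (bound := fun y => M * |φ y|)
    univ_mem (Eventually.of_forall fun x => aestronglyMeasurable_smul_shift hWc hφ x)
    (integrable_smul_shift hWc hM0 hφ x₀) (aestronglyMeasurable_smul_shift hDWc hφ x₀)
    (Eventually.of_forall fun y x _ => norm_smul_shift_le hM1 φ x y) (hφ.abs.const_mul M)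
    (Eventually.of_forall fun y x _ => ?_)
  -- `x ↦ φ y • W (x - y)` has derivative `φ y • DW(x - y)`
  have h1 : HasFDerivAt (fun x : E => x - y) (ContinuousLinearMap.id ℝ E) x := (hasFDerivAt_id x).sub_const y
  have h2 := (hWd (x - y)).comp x h1
  simp only [ContinuousLinearMap.comp_id] at h2
  exact h2.const_smul (φ y)

/-- `fderiv (W ⋆ φ) = (DW) ⋆ φ`. -/
theorem fderiv_hconv {W : E → F} (hW : ContDiff ℝ 1 W) {M : ℝ} (hM0 : ∀ x, ‖W x‖ ≤ M)
    (hM1 : ∀ x, ‖fderiv ℝ W x‖ ≤ M) {φ : E → ℝ} (hφ : Integrable φ) :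
    fderiv ℝ (hconv W φ) = hconv (fderiv ℝ W) φ :=
  funext fun x => (hasFDerivAt_hconv hW hM0 hM1 hφ x).fderiv

/-- `W ⋆ φ` is differentiable. -/
theorem differentiable_hconv {W : E → F} (hW : ContDiff ℝ 1 W) {M : ℝ} (hM0 : ∀ x, ‖W x‖ ≤ M)
    (hM1 : ∀ x, ‖fderiv ℝ W x‖ ≤ M) {φ : E → ℝ} (hφ : Integrable φ) : Differentiable ℝ (hconv W φ) :=
  fun x => (hasFDerivAt_hconv hW hM0 hM1 hφ x).differentiableAt

/-- `W ⋆ φ ∈ C¹`. [folklore] -/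
theorem contDiff_one_hconv {W : E → F} (hW : ContDiff ℝ 1 W) {M : ℝ} (hM0 : ∀ x, ‖W x‖ ≤ M)
    (hM1 : ∀ x, ‖fderiv ℝ W x‖ ≤ M) {φ : E → ℝ} (hφ : Integrable φ) : ContDiff ℝ 1 (hconv W φ) := by
  rw [contDiff_one_iff_fderiv]
  refine ⟨differentiable_hconv hW hM0 hM1 hφ, ?_⟩
  rw [fderiv_hconv hW hM0 hM1 hφ]
  exact continuous_hconv (hW.continuous_fderiv one_ne_zero) hM1 hφ

/-- `W ⋆ φ ∈ C²` for `W ∈ C²` with `W, DW, D²W` bounded: `D²(W ⋆ φ) = (D²W) ⋆ φ`. [folklore] -/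
theorem contDiff_two_hconv {W : E → F} (hW : ContDiff ℝ 2 W) {M : ℝ} (hM0 : ∀ x, ‖W x‖ ≤ M)
    (hM1 : ∀ x, ‖fderiv ℝ W x‖ ≤ M) (hM2 : ∀ x, ‖fderiv ℝ (fderiv ℝ W) x‖ ≤ M) {φ : E → ℝ} (hφ : Integrable φ) :
    ContDiff ℝ 2 (hconv W φ) := by
  have hW1 : ContDiff ℝ 1 W := hW.of_le (by norm_num)
  have hDW1 : ContDiff ℝ 1 (fderiv ℝ W) := hW.fderiv_right (m := 1) (by norm_num)
  rw [show (2 : WithTop ℕ∞) = 1 + 1 from rfl, contDiff_succ_iff_fderiv]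
  refine ⟨differentiable_hconv hW1 hM0 hM1 hφ, by simp, ?_⟩
  rw [fderiv_hconv hW1 hM0 hM1 hφ]
  exact contDiff_one_hconv hDW1 hM1 hM2 hφ

/-! ### Scalar corollaries: gradient and `div ∇` -/

/-- `∇(w ⋆ φ) = (∇w) ⋆ φ`. [folklore] -/
theorem gradient_hconv {w : E → ℝ} (hw : ContDiff ℝ 1 w) {M : ℝ} (hM0 : ∀ x, ‖w x‖ ≤ M)
    (hM1 : ∀ x, ‖fderiv ℝ w x‖ ≤ M) (hG0 : ∀ x, ‖gradient w x‖ ≤ M) {φ : E → ℝ} (hφ : Integrable φ) (x : E) :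
    gradient (hconv w φ) x = hconv (gradient w) φ x := by
  haveI : CompleteSpace E := FiniteDimensional.complete ℝ E
  have hD : fderiv ℝ (hconv w φ) x = hconv (fderiv ℝ w) φ x := congrFun (fderiv_hconv hw hM0 hM1 hφ) x
  have hint : Integrable (fun y => φ y • fderiv ℝ w (x - y)) :=
    integrable_smul_shift (hw.continuous_fderiv one_ne_zero) hM1 hφ x
  have hgc : Continuous (gradient w) :=
    (toDual ℝ E).symm.continuous.comp (hw.continuous_fderiv one_ne_zero)
  have hintg : Integrable (fun y => φ y • gradient w (x - y)) := integrable_smul_shift hgc hG0 hφ x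
  refine ext_inner_right ℝ fun v => ?_
  rw [gradient, InnerProductSpace.toDual_symm_apply, hD]
  unfold hconv
  rw [ContinuousLinearMap.integral_apply hint v, real_inner_comm, ← integral_inner hintg v]
  refine integral_congr_ae (Eventually.of_forall fun y => ?_)
  simp only [_root_.FunLike.coe_smul, Pi.smul_apply, smul_eq_mul, real_inner_smul_right]
  rw [real_inner_comm, gradient, InnerProductSpace.toDual_symm_apply]

/-- **`div ∇ (w ⋆ φ) = (div ∇ w) ⋆ φ`** for `w ∈ C²` with `w, Dw, ∇w, D∇w` bounded and `φ ∈ L¹`. [folklore] -/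
theorem divergence_gradient_hconv {w : E → ℝ} (hw : ContDiff ℝ 2 w) {M : ℝ} (hM0 : ∀ x, ‖w x‖ ≤ M)
    (hM1 : ∀ x, ‖fderiv ℝ w x‖ ≤ M) (hG0 : ∀ x, ‖gradient w x‖ ≤ M) (hG1 : ∀ x, ‖fderiv ℝ (gradient w) x‖ ≤ M)
    {φ : E → ℝ} (hφ : Integrable φ) (x : E) :
    Literature.Analysis.FluidPDE.VectorCalculus.divergence (gradient (hconv w φ)) x =
      hconv (fun y => Literature.Analysis.FluidPDE.VectorCalculus.divergence (gradient w) y) φ x := by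
  haveI : CompleteSpace E := FiniteDimensional.complete ℝ E
  have hw1 : ContDiff ℝ 1 w := hw.of_le (by norm_num)
  -- `∇(w ⋆ φ) = (∇w) ⋆ φ` as functions
  have hg : gradient (hconv w φ) = hconv (gradient w) φ := funext fun y => gradient_hconv hw1 hM0 hM1 hG0 hφ y
  -- `∇w ∈ C¹`
  have hgc : ContDiff ℝ 1 (gradient w) := by
    have e1 : gradient w = fun y => (toDual ℝ E).symm (fderiv ℝ w y) := rfl
    rw [e1]
    exact (toDual ℝ E).symm.toContinuousLinearEquiv.contDiff.comp (hw.fderiv_right (m := 1) (by norm_num))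
  have hD2 : fderiv ℝ (hconv (gradient w) φ) x = hconv (fderiv ℝ (gradient w)) φ x :=
    congrFun (fderiv_hconv hgc hG0 hG1 hφ) x
  have hint : Integrable (fun y => φ y • fderiv ℝ (gradient w) (x - y)) :=
    integrable_smul_shift (hgc.continuous_fderiv one_ne_zero) hG1 hφ x
  rw [hg, divergence_eq_traceCLM, hD2]
  unfold hconv
  rw [← traceCLM.integral_comp_comm hint]
  refine integral_congr_ae (Eventually.of_forall fun y => ?_)
  simp only [map_smul, smul_eq_mul, divergence_eq_traceCLM]

/-! ### A `z`-family: the height derivative falls on the field too -/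

/-- **`∂_z (w(z,·) ⋆ φ)(x) = (∂_z w(z,·) ⋆ φ)(x)`** for a family `w : ℝ → E → ℝ` differentiable in `z` at every point with
`|∂_z w| ≤ M`, each `w(z,·)` continuous, `∂_z w(z,·)` continuous, `φ ∈ L¹`. [folklore] -/
theorem hasDerivAt_hconv_param {w wz : ℝ → E → ℝ} (hwc : ∀ z, Continuous (w z)) (hwzc : ∀ z, Continuous (wz z))
    {M : ℝ} (hM : ∀ z x, |w z x| ≤ M) (hMz : ∀ z x, |wz z x| ≤ M)
    (hd : ∀ x z, HasDerivAt (fun s => w s x) (wz z x) z) {φ : E → ℝ} (hφ : Integrable φ) (x : E) (z₀ : ℝ) :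
    HasDerivAt (fun s => hconv (w s) φ x) (hconv (wz z₀) φ x) z₀ := by
  unfold hconv
  simp only [smul_eq_mul]
  have h := hasDerivAt_integral_of_dominated_loc_of_deriv_le (μ := (volume : Measure E)) (s := univ) (x₀ := z₀)
    (F := fun s y => φ y * w s (x - y)) (F' := fun s y => φ y * wz s (x - y)) (bound := fun y => M * |φ y|)
    univ_mem
    (Eventually.of_forall fun s =>
      hφ.aestronglyMeasurable.mul ((hwc s).comp (continuous_const.sub continuous_id)).aestronglyMeasurable)
    ?_ (hφ.aestronglyMeasurable.mul ((hwzc z₀).comp (continuous_const.sub continuous_id)).aestronglyMeasurable)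
    (Eventually.of_forall fun y s _ => by
      rw [Real.norm_eq_abs, abs_mul, mul_comm]
      exact mul_le_mul_of_nonneg_right (hMz s _) (abs_nonneg _))
    (hφ.abs.const_mul M)
    (Eventually.of_forall fun y s _ => (hd (x - y) s).const_mul (φ y))
  · exact h.2
  · exact (hφ.abs.const_mul M).mono'
      (hφ.aestronglyMeasurable.mul ((hwc z₀).comp (continuous_const.sub continuous_id)).aestronglyMeasurable)
      (Eventually.of_forall fun y => by
        rw [Real.norm_eq_abs, abs_mul, mul_comm]
        exact mul_le_mul_of_nonneg_right (hM z₀ _) (abs_nonneg _))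

end Measure

end Summit.NavierStokesRegularity.NavierStokesRegularity.Theorems.PoloidalWindowDoorPoloidalWindowRigidityHorizontalConvolution
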